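import Summits.ResolutionOfSingularities.ResolutionOfSingularities.Theorems.PurelyInseparableDim4SwapTransportRotation
import Mathlib.Algebra.MvPolynomial.Division
import HarnessLib
import HarnessLib.Audit.Tags

/-!
# Purely inseparable four-folds — THE CANONICAL TRANSPORT of a re-presentation through one point step, for ANY slot set and
# ANY pair (real chart, virtual chart) (cell `res-dim4-pi`, K2(p) lane, slice C; hN4-D «D∞ pair-confinement re-presentation»,
# file F1 of res-dim4-typ-1 g4's design of record, bus 2026-08-29T07:44:53Z)

[OURS · counted 0 · cell `res-dim4-pi` · K2(p) lane (holder res-dim4-p-12 g4, HOLDER WORD g4-4: hN4-D = the second route to the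
D∞ branch, socket `ResCone.no_dInf_tail_of_representation` p703603) · seat res-dim4-typ-1 g4.]  Nothing here proves hN4-D,
TAIL-D, K2(p)/K2(5), `NoIsolatedTrap 5 5` or resolution of singularities in dimension ≥ 4 / characteristic `p` — NOT proved.
AI kernel work, weaker than expert review.

WHY CANONICAL.  res-dim4-typ-1 g3's `unitFrame_step₂` / `unitFrame_rotate₂` transport a slot-unit frame through a slot step /
a rotation, each with its own letter bookkeeping, and return the new frame EXISTENTIALLY.  The D∞ re-presentation (hN4-D) needs
(a) every combination of real chart / virtual chart / dropped slots ((2)→(2,1) in a free virtual chart, (2,1)→(2,1) keep,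
(2,1)→(2) GENUINELY LOSSY drop), and (b) an `M`-INDEPENDENT virtual translation at the drop steps, where the direction is NOT
kernel-determined — obtained from the COHERENCE of the transported frames across precisions, which requires the transport to be a
FUNCTION of its inputs.  So here the transport is ONE DEFINITION for all cases:
* §1 `blowupSub ℓ β` (`x_ℓ ↦ x_ℓ`, `x_i ↦ x_ℓ (x_i + β_i)`), `blowupFactor ℓ β G := (G ∘ blowupSub) / x_ℓ` (exact division for
  origin-free `G`, `MvPolynomial.divMonomial`), with `G̃(0) = ∂_ℓ G(0) + Σ_{i ≠ ℓ} ∂_i G(0)·β_i` and `coeff_{x_k} G̃ = coeff_{x_k} G`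
  (`k ≠ ℓ`) (res-dim4-typ-1 g3's `exists_blowup_factor`), `blowupFactor (x_i · E) = (x_i + β_i)·(E ∘ blowupSub)`;
* §2 `invModPow V M` — THE geometric-sum inverse of a unit modulo `𝔪₀^{M+1}` (res-dim4-typ-1 g3's `exists_inv_mod_pow` as a
  definition) with its constant term and linear coefficients;
* §3 `transθ θ ℓ β jr b M` / `transU θ U ℓ β jr`: for an origin-fixing substitution `θ` (real letters ↦ polynomials in the
  virtual letters), a virtual chart `ℓ` with translation `β` (`β ℓ = 0`) and a real chart `jr` with translation `b` (`b jr = 0`):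
  `transθ jr := x_ℓ · G̃_jr`, `transθ k := W · G̃_k − b_k` (`k ≠ jr`), `W = invModPow G̃_jr M`;
* §4 **`transport`**: if `B.F = clean(Uᵖ · θ(A.F)) + E`, `E ∈ 𝔪₀ᴹ`, and the two points CORRESPOND through the tangent map —
  `hdir : ∂_ℓ θ_k(0) + Σ_{i ≠ ℓ} ∂_i θ_k(0)·β_i = λ·(b_k + [k = jr])` with `λ ≠ 0` — then the children `step p univ ℓ β B` and
  `step p univ jr b A` satisfy the same relation with `transθ`, `transU` and an error in `𝔪₀^{M−p}`; `transθ` fixes the origin,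
  `transU(0) = U(0)·λ`; the SLOT FORM is reproduced exactly where it should be: `transθ jr = x_ℓ · V`, `V(0) = λ` (the newborn),
  and `θ_k = x_i · E_i` with `i ≠ ℓ`, `β_i = 0` ⟹ `b_k = 0` and `transθ k = x_i · (E_i ∘ blowupSub · W)` (a kept slot);
  TANGENT ROWS `λ · coeff_{x_m}(transθ k) = coeff_{x_m} θ_k − b_k · coeff_{x_m} θ_jr` (`k ≠ jr`, `m ≠ ℓ`) and
  `coeff_{x_m}(transθ jr) = λ·[m = ℓ]`.
The proof of `transport` is `unitFrame_rotate₂`'s, letter-generic (congruence `x_ℓ G̃_k (V W − 1)` for every `k ≠ jr`).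
[cite: Hauser2010, §§F–G (chart expressions of a point blowup; cleaning)] [folklore]
bears_on: LADDER-RESOLUTION:D157-DOOR2 (res-dim4-pi · K2(p) slice C · hN4-D F1 canonical transport).  Supports
stmt-ResolutionOfSingularities-16155 (helper).
-/

set_option linter.dupNamespace false -- mandated namespace of this single-conjunct summit

noncomputable section

namespace Summit.ResolutionOfSingularities.ResolutionOfSingularities.Theorems.PIDim4

namespace SwapTransport

open MvPolynomial Finset
open Literature.AlgebraicGeometry.Resolution
open Literature.AlgebraicGeometry.Resolution.CentreBlowup
open Literature.AlgebraicGeometry.Resolution.Hauser2010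

variable {K : Type} [Field K]

/-! ## §1 The blow-up substitution and the blow-up factor -/

/-- **The blow-up substitution** of the chart `x_ℓ` at the point `β` of the exceptional hyperplane: `x_ℓ ↦ x_ℓ`,
`x_i ↦ x_ℓ · (x_i + β_i)` (`i ≠ ℓ`). [cite: Hauser2010, §F] -/
def blowupSub (ℓ : Fin 4) (β : Fin 4 → K) : Fin 4 → MvPolynomial (Fin 4) K :=
  fun i => if i = ℓ then (X ℓ : MvPolynomial (Fin 4) K) else X ℓ * (X i + C (β i))

/-- Unfolding lemma. [folklore] -/
theorem blowupSub_def (ℓ : Fin 4) (β : Fin 4 → K) :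
    blowupSub ℓ β = fun i => if i = ℓ then (X ℓ : MvPolynomial (Fin 4) K) else X ℓ * (X i + C (β i)) := rfl

/-- The chart letter is fixed. [folklore] -/
theorem blowupSub_self (ℓ : Fin 4) (β : Fin 4 → K) : blowupSub ℓ β ℓ = X ℓ := by
  rw [blowupSub_def]; simp

/-- The other letters: `x_i ↦ x_ℓ (x_i + β_i)`. [folklore] -/
theorem blowupSub_of_ne {ℓ i : Fin 4} (β : Fin 4 → K) (hi : i ≠ ℓ) : blowupSub ℓ β i = X ℓ * (X i + C (β i)) := by
  rw [blowupSub_def]; simp [hi]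

/-- The blow-up substitution fixes the origin. [folklore] -/
theorem constantCoeff_blowupSub (ℓ : Fin 4) (β : Fin 4 → K) (i : Fin 4) : constantCoeff (blowupSub ℓ β i) = 0 := by
  rw [blowupSub_def]; exact constantCoeff_blowup ℓ β i

/-- It preserves constant terms. [folklore] -/
theorem constantCoeff_aeval_blowupSub (ℓ : Fin 4) (β : Fin 4 → K) (H : MvPolynomial (Fin 4) K) :
    constantCoeff (aeval (blowupSub ℓ β) H) = constantCoeff H :=
  CoordChange.constantCoeff_aeval_of_origin _ (constantCoeff_blowupSub ℓ β) H

/-- Every image is flat along `x_ℓ`: `H ∘ blowupSub ≡ H(0) mod (x_ℓ)`. [folklore] -/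
theorem aeval_blowupSub_sub_C_mem (ℓ : Fin 4) (β : Fin 4 → K) (H : MvPolynomial (Fin 4) K) :
    aeval (blowupSub ℓ β) H - C (constantCoeff H) ∈ Ideal.span {(X ℓ : MvPolynomial (Fin 4) K)} := by
  rw [blowupSub_def]; exact aeval_blowup_sub_C_mem ℓ β H

/-- **The blow-up factor** `G̃ := (G ∘ blowupSub) / x_ℓ` (exact for origin-free `G`). [cite: Hauser2010, §F] -/
def blowupFactor (ℓ : Fin 4) (β : Fin 4 → K) (G : MvPolynomial (Fin 4) K) : MvPolynomial (Fin 4) K :=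
  (aeval (blowupSub ℓ β) G).divMonomial (Finsupp.single ℓ 1)

/-- **`G ∘ blowupSub = x_ℓ · G̃`** for origin-free `G`, with `G̃(0) = ∂_ℓ G(0) + Σ_{i ≠ ℓ} ∂_i G(0)·β_i` and
`coeff_{x_k} G̃ = coeff_{x_k} G` (`k ≠ ℓ`). [cite: Hauser2010, §F] [folklore] -/
theorem blowupFactor_spec (ℓ : Fin 4) (β : Fin 4 → K) {G : MvPolynomial (Fin 4) K} (hG0 : constantCoeff G = 0) :
    X ℓ * blowupFactor ℓ β G = aeval (blowupSub ℓ β) G ∧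
      constantCoeff (blowupFactor ℓ β G) = coeff (Finsupp.single ℓ 1) G +
        ∑ i ∈ Finset.univ.erase ℓ, coeff (Finsupp.single i 1) G * β i ∧
      ∀ k, k ≠ ℓ → coeff (Finsupp.single k 1) (blowupFactor ℓ β G) = coeff (Finsupp.single k 1) G := by
  classical
  obtain ⟨Gt, hGt, hGt0, hGt1⟩ := exists_blowup_factor (ℓ := ℓ) β hG0
  rw [← blowupSub_def] at hGt
  have hfac : blowupFactor ℓ β G = Gt := by
    unfold blowupFactor
    rw [hGt, X_mul_divMonomial]
  rw [hfac]
  exact ⟨hGt.symm, hGt0, hGt1⟩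

/-- The blow-up factor of a slot form off the chart: `blowupFactor (x_i · E) = (x_i + β_i) · (E ∘ blowupSub)` (`i ≠ ℓ`).
[folklore] -/
theorem blowupFactor_X_mul {ℓ i : Fin 4} (β : Fin 4 → K) (hi : i ≠ ℓ) (E : MvPolynomial (Fin 4) K) :
    blowupFactor ℓ β (X i * E) = (X i + C (β i)) * aeval (blowupSub ℓ β) E := by
  unfold blowupFactor
  rw [map_mul, aeval_X, blowupSub_of_ne β hi, mul_assoc, X_mul_divMonomial]

/-- The blow-up factor of a slot form AT the chart: `blowupFactor (x_ℓ · E) = E ∘ blowupSub`. [folklore] -/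
theorem blowupFactor_X_mul_self (ℓ : Fin 4) (β : Fin 4 → K) (E : MvPolynomial (Fin 4) K) :
    blowupFactor ℓ β (X ℓ * E) = aeval (blowupSub ℓ β) E := by
  unfold blowupFactor
  rw [map_mul, aeval_X, blowupSub_self, X_mul_divMonomial]

/-! ## §2 The geometric-sum inverse modulo a power of `𝔪₀` -/

/-- **The inverse of a unit modulo `𝔪₀^{M+1}`** (geometric sum in `q = −V(0)⁻¹ (V − V(0))`). [folklore] -/
def invModPow (V : MvPolynomial (Fin 4) K) (M : ℕ) : MvPolynomial (Fin 4) K :=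
  C (constantCoeff V)⁻¹ * ∑ k ∈ Finset.range (M + 1), (-(C (constantCoeff V)⁻¹ * (V - C (constantCoeff V)))) ^ k

/-- **`invModPow V M` inverts `V` modulo `𝔪₀ᴹ`**, with `W(0)·V(0) = 1` and `V(0)·coeff_{x_i} W = −W(0)·coeff_{x_i} V`
(`M ≥ 2`). [folklore] -/
theorem invModPow_spec {V : MvPolynomial (Fin 4) K} (hV : constantCoeff V ≠ 0) {M : ℕ} (hM : 2 ≤ M) :
    constantCoeff (invModPow V M) * constantCoeff V = 1 ∧ invModPow V M * V - 1 ∈ originIdeal K ^ M ∧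
      ∀ i, constantCoeff V * coeff (Finsupp.single i 1) (invModPow V M) =
        -(constantCoeff (invModPow V M) * coeff (Finsupp.single i 1) V) := by
  obtain ⟨c, hc⟩ : ∃ c : K, c = constantCoeff V := ⟨_, rfl⟩
  rw [← hc] at hV
  obtain ⟨q, hq⟩ : ∃ q : MvPolynomial (Fin 4) K, q = -(C c⁻¹ * (V - C c)) := ⟨_, rfl⟩
  have hW : invModPow V M = C c⁻¹ * ∑ k ∈ Finset.range (M + 1), q ^ k := by
    unfold invModPow; rw [← hc, hq]
  have hq0 : constantCoeff q = 0 := by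
    rw [hq, map_neg, map_mul, map_sub, constantCoeff_C, constantCoeff_C, ← hc, sub_self, mul_zero, neg_zero]
  have hVq : V = C c * (1 - q) := by
    rw [hq, mul_sub, mul_one, mul_neg, ← mul_assoc, ← C_mul, mul_inv_cancel₀ hV, C_1, one_mul]
    ring
  have hW0 : constantCoeff (C c⁻¹ * ∑ k ∈ Finset.range (M + 1), q ^ k) = c⁻¹ := by
    rw [map_mul, constantCoeff_C, map_sum, Finset.sum_range_succ', pow_zero, map_one,
      Finset.sum_eq_zero (fun k _ => by rw [pow_succ, map_mul, hq0, mul_zero]), zero_add, mul_one]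
  have hinv : (C c⁻¹ * ∑ k ∈ Finset.range (M + 1), q ^ k) * V - 1 ∈ originIdeal K ^ M := by
    rw [hVq, show C c⁻¹ * (∑ k ∈ Finset.range (M + 1), q ^ k) * (C c * (1 - q)) =
        (C c⁻¹ * C c) * ((1 - q) * ∑ k ∈ Finset.range (M + 1), q ^ k) by ring, mul_neg_geom_sum, ← C_mul,
      inv_mul_cancel₀ hV, C_1, one_mul, sub_sub_cancel_left]
    refine Submodule.neg_mem _ (Ideal.pow_le_pow_right (Nat.le_succ M) (Ideal.pow_mem_pow ?_ _))
    exact (NarrowApolarity.mem_originIdeal_iff q).mpr hq0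
  rw [hW, ← hc]
  refine ⟨?_, hinv, fun i => ?_⟩
  · rw [hW0, inv_mul_cancel₀ hV]
  · have h0 : coeff (Finsupp.single i 1) ((C c⁻¹ * ∑ k ∈ Finset.range (M + 1), q ^ k) * V - 1) = 0 :=
      (IsolationCert.mem_originIdeal_pow_iff M _).mp hinv _ (by rw [Finsupp.degree_single]; omega)
    rw [coeff_sub, coeff_one, if_neg (Ne.symm (Finsupp.single_ne_zero.mpr one_ne_zero)), sub_zero,
      coeff_single_mul_add, hW0, ← hc] at h0
    rw [hW0]
    linear_combination h0

/-! ## §3 The canonical transported frame -/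

/-- **The transported substitution** (real letters of the child ↦ polynomials in the virtual child's letters): the real chart
letter `jr` goes to `x_ℓ · G̃_jr`, every other real letter `k` to `W · G̃_k − b_k` with `W` the inverse of `G̃_jr` modulo `𝔪₀ᴹ`.
[cite: Hauser2010, §§F–G] -/
def transθ (θ : Fin 4 → MvPolynomial (Fin 4) K) (ℓ : Fin 4) (β : Fin 4 → K) (jr : Fin 4) (b : Fin 4 → K) (M : ℕ) :
    Fin 4 → MvPolynomial (Fin 4) K :=
  fun k => if k = jr then X ℓ * blowupFactor ℓ β (θ jr)
    else invModPow (blowupFactor ℓ β (θ jr)) M * blowupFactor ℓ β (θ k) - C (b k)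

/-- **The transported unit**: `U′ = (U ∘ blowupSub) · G̃_jr`. [cite: Hauser2010, §G] -/
def transU (θ : Fin 4 → MvPolynomial (Fin 4) K) (U : MvPolynomial (Fin 4) K) (ℓ : Fin 4) (β : Fin 4 → K) (jr : Fin 4) :
    MvPolynomial (Fin 4) K :=
  aeval (blowupSub ℓ β) U * blowupFactor ℓ β (θ jr)

/-- Unfolding at the real chart letter. [folklore] -/
theorem transθ_self (θ : Fin 4 → MvPolynomial (Fin 4) K) (ℓ : Fin 4) (β : Fin 4 → K) (jr : Fin 4) (b : Fin 4 → K)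
    (M : ℕ) : transθ θ ℓ β jr b M jr = X ℓ * blowupFactor ℓ β (θ jr) := by
  unfold transθ; rw [if_pos rfl]

/-- Unfolding off the real chart letter. [folklore] -/
theorem transθ_of_ne (θ : Fin 4 → MvPolynomial (Fin 4) K) (ℓ : Fin 4) (β : Fin 4 → K) {jr k : Fin 4} (b : Fin 4 → K)
    (M : ℕ) (hk : k ≠ jr) :
    transθ θ ℓ β jr b M k = invModPow (blowupFactor ℓ β (θ jr)) M * blowupFactor ℓ β (θ k) - C (b k) := by
  unfold transθ; rw [if_neg hk]

/-- **The blow-up factor at the real chart letter is a unit with constant term `λ`** under the direction correspondence.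
[folklore] -/
theorem constantCoeff_blowupFactor_of_dir {θ : Fin 4 → MvPolynomial (Fin 4) K} (hθ0 : ∀ k, constantCoeff (θ k) = 0)
    {ℓ jr : Fin 4} {β b : Fin 4 → K} {lam : K}
    (hdir : ∀ k, coeff (Finsupp.single ℓ 1) (θ k) + ∑ i ∈ Finset.univ.erase ℓ, coeff (Finsupp.single i 1) (θ k) * β i =
      lam * (b k + if k = jr then 1 else 0)) (k : Fin 4) :
    constantCoeff (blowupFactor ℓ β (θ k)) = lam * (b k + if k = jr then 1 else 0) := by
  rw [(blowupFactor_spec ℓ β (hθ0 k)).2.1, hdir k]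

/-! ## §4 THE TRANSPORT THEOREM -/

/-- **THE CANONICAL TRANSPORT THROUGH ONE POINT STEP.**  From `B.F = clean(Uᵖ · θ(A.F)) + E` (`E ∈ 𝔪₀ᴹ`, `M ≥ 2`, `θ`
origin-fixing, both orders `≥ p`), a virtual chart `ℓ` / translation `β` (`β ℓ = 0`), a real chart `jr` / translation `b`
(`b jr = 0`) and the DIRECTION CORRESPONDENCE `hdir` with `λ ≠ 0`: `transθ` fixes the origin, `transU(0) = U(0)·λ`, and
`(step p univ ℓ β B).F = clean(transUᵖ · transθ (step p univ jr b A).F) + E′` with `E′ ∈ 𝔪₀^{M−p}`. [OURS]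
[cite: Hauser2010, §§F–G (chart expressions of a point blowup; cleaning)] -/
theorem transport (p : ℕ) [Fact p.Prime] [CharP K p] [DecidableEq K] {M : ℕ} (hM2 : 2 ≤ M) {A B : State K}
    {θ : Fin 4 → MvPolynomial (Fin 4) K} {U E : MvPolynomial (Fin 4) K} (hθ0 : ∀ k, constantCoeff (θ k) = 0)
    (hE : E ∈ originIdeal K ^ M) (hrel : B.F = deletePthPowers p (U ^ p * aeval θ A.F) + E)
    (hA : (p : ℕ∞) ≤ ordAlong Finset.univ A.F) (hB : (p : ℕ∞) ≤ ordAlong Finset.univ B.F)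
    {ℓ jr : Fin 4} {β b : Fin 4 → K} (hβℓ : β ℓ = 0) (hbj : b jr = 0) {lam : K} (hlam : lam ≠ 0)
    (hdir : ∀ k, coeff (Finsupp.single ℓ 1) (θ k) + ∑ i ∈ Finset.univ.erase ℓ, coeff (Finsupp.single i 1) (θ k) * β i =
      lam * (b k + if k = jr then 1 else 0)) :
    (∀ k, constantCoeff (transθ θ ℓ β jr b M k) = 0) ∧
      constantCoeff (transU θ U ℓ β jr) = constantCoeff U * lam ∧
      ∃ E' : MvPolynomial (Fin 4) K, E' ∈ originIdeal K ^ (M - p) ∧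
        (step p Finset.univ ℓ β B).F =
          deletePthPowers p (transU θ U ℓ β jr ^ p * aeval (transθ θ ℓ β jr b M) (step p Finset.univ jr b A).F) + E' := by
  classical
  -- abbreviations
  obtain ⟨βs, hβs⟩ : ∃ βs : Fin 4 → MvPolynomial (Fin 4) K, βs = blowupSub ℓ β := ⟨_, rfl⟩
  obtain ⟨αs, hαs⟩ : ∃ αs : Fin 4 → MvPolynomial (Fin 4) K, αs = blowupSub jr b := ⟨_, rfl⟩
  obtain ⟨Gt, hGt⟩ : ∃ Gt : Fin 4 → MvPolynomial (Fin 4) K, Gt = fun k => blowupFactor ℓ β (θ k) := ⟨_, rfl⟩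
  obtain ⟨V, hV⟩ : ∃ V : MvPolynomial (Fin 4) K, V = blowupFactor ℓ β (θ jr) := ⟨_, rfl⟩
  obtain ⟨W, hW⟩ : ∃ W : MvPolynomial (Fin 4) K, W = invModPow V M := ⟨_, rfl⟩
  obtain ⟨θ', hθ'⟩ : ∃ θ' : Fin 4 → MvPolynomial (Fin 4) K, θ' = transθ θ ℓ β jr b M := ⟨_, rfl⟩
  obtain ⟨U', hU'⟩ : ∃ U' : MvPolynomial (Fin 4) K, U' = transU θ U ℓ β jr := ⟨_, rfl⟩
  have hGtV : Gt jr = V := by rw [hGt, hV]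
  -- the blow-up factors
  have hGtX : ∀ k, X ℓ * Gt k = aeval βs (θ k) := fun k => by
    rw [hGt, hβs]; exact (blowupFactor_spec ℓ β (hθ0 k)).1
  have hGt0 : ∀ k, constantCoeff (Gt k) = lam * (b k + if k = jr then 1 else 0) := fun k => by
    rw [hGt]; exact constantCoeff_blowupFactor_of_dir hθ0 hdir k
  have hV0 : constantCoeff V = lam := by rw [← hGtV, hGt0, if_pos rfl, hbj, zero_add, mul_one]
  -- the inverse `W` of `V` modulo `𝔪₀ᴹ`
  obtain ⟨hWc, hWinv, -⟩ := invModPow_spec (V := V) (by rw [hV0]; exact hlam) hM2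
  rw [← hW, hV0] at hWc
  rw [← hW] at hWinv
  obtain ⟨w, hw⟩ : ∃ w : K, w = constantCoeff W := ⟨_, rfl⟩
  rw [← hw] at hWc
  -- the new frame, letter by letter
  have hθ'j : θ' jr = X ℓ * V := by rw [hθ', transθ_self, hV]
  have hθ'k : ∀ k, k ≠ jr → θ' k = W * Gt k - C (b k) := fun k hk => by
    rw [hθ', transθ_of_ne θ ℓ β b M hk, hW, hV, hGt]
  have hU'def : U' = aeval βs U * V := by rw [hU', hβs, hV]; rfl
  -- the substitutions fix the origin
  have hβ0 : ∀ i, constantCoeff (βs i) = 0 := fun i => by rw [hβs]; exact constantCoeff_blowupSub ℓ β i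
  have hεc : ∀ H : MvPolynomial (Fin 4) K, constantCoeff (aeval βs H) = constantCoeff H := fun H => by
    rw [hβs]; exact constantCoeff_aeval_blowupSub ℓ β H
  have hαj : αs jr = X jr := by rw [hαs, blowupSub_self]
  have hαk : ∀ k, k ≠ jr → αs k = X jr * (X k + C (b k)) := fun k hk => by rw [hαs, blowupSub_of_ne b hk]
  -- the chart identities
  have hBch : aeval βs B.F = X ℓ ^ p * PointBlowup.translate β (chartTransform p Finset.univ ℓ B.F) := by
    rw [hβs, blowupSub_def]; exact FreeTailProof.aeval_blowup_eq p ℓ β hβℓ B.F hB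
  have hAch : aeval αs A.F = X jr ^ p * PointBlowup.translate b (chartTransform p Finset.univ jr A.F) := by
    rw [hαs, blowupSub_def]; exact FreeTailProof.aeval_blowup_eq p jr b hbj A.F hA
  -- the letterwise congruence `θ′∘α ≡ β∘θ mod 𝔪₀ᴹ`
  have hΘ : ∀ k, aeval θ' (αs k) - aeval βs (θ k) ∈ originIdeal K ^ M := by
    intro k
    by_cases hk : k = jr
    · rw [hk, hαj, aeval_X, hθ'j, hGtV.symm, hGtX, sub_self]
      exact Submodule.zero_mem _
    · rw [hαk k hk, map_mul, map_add, aeval_X, aeval_X, aeval_C, algebraMap_eq, hθ'j, hθ'k k hk, sub_add_cancel, ← hGtX k,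
        show X ℓ * V * (W * Gt k) - X ℓ * Gt k = X ℓ * Gt k * (W * V - 1) by ring]
      exact Ideal.mul_mem_left _ _ hWinv
  have hD : aeval (fun k => aeval θ' (αs k)) A.F - aeval (fun k => aeval βs (θ k)) A.F ∈ originIdeal K ^ M :=
    ApproxCoordChange.aeval_sub_aeval_mem hΘ A.F
  -- abbreviations for the two point transforms and the error
  obtain ⟨TA, hTA⟩ : ∃ TA : MvPolynomial (Fin 4) K,
      TA = PointBlowup.translate b (chartTransform p Finset.univ jr A.F) := ⟨_, rfl⟩
  obtain ⟨TB, hTB⟩ : ∃ TB : MvPolynomial (Fin 4) K,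
      TB = PointBlowup.translate β (chartTransform p Finset.univ ℓ B.F) := ⟨_, rfl⟩
  have hstepB : (step p Finset.univ ℓ β B).F = deletePthPowers p TB := by rw [hTB]; rfl
  have hstepA : (step p Finset.univ jr b A).F = deletePthPowers p TA := by rw [hTA]; rfl
  rw [← hTB] at hBch
  rw [← hTA] at hAch
  obtain ⟨D, hDdef⟩ : ∃ D : MvPolynomial (Fin 4) K,
      D = aeval (fun k => aeval θ' (αs k)) A.F - aeval (fun k => aeval βs (θ k)) A.F := ⟨_, rfl⟩
  rw [← hDdef] at hD
  -- the key identity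
  have hθ'jp : aeval θ' (X jr ^ p * TA) = (X ℓ * V) ^ p * aeval θ' TA := by
    rw [map_mul, map_pow, aeval_X, hθ'j]
  have hkey : X ℓ ^ p * deletePthPowers p TB =
      X ℓ ^ p * deletePthPowers p (U' ^ p * aeval θ' (deletePthPowers p TA)) +
        (deletePthPowers p (aeval βs E) - deletePthPowers p (aeval βs U ^ p * D)) := by
    have h1 : X ℓ ^ p * deletePthPowers p TB = deletePthPowers p (aeval βs B.F) := by
      rw [← deletePthPowers_X_pow_mul, hBch]
    have h2 : aeval βs (U ^ p * aeval θ A.F) = X ℓ ^ p * (U' ^ p * aeval θ' TA) - aeval βs U ^ p * D := by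
      rw [map_mul, map_pow, ApproxCoordChange.aeval_aeval, hDdef, ← ApproxCoordChange.aeval_aeval θ' αs, hAch, hθ'jp, hU'def]
      ring
    rw [h1, hrel, map_add, deletePthPowers_add, deletePthPowers_aeval_deletePthPowers, h2, SwapNorm.deletePthPowers_sub',
      deletePthPowers_X_pow_mul, SwapNorm.deletePthPowers_mul_aeval_deletePthPowers]
    ring
  obtain ⟨E', hE'⟩ : ∃ E' : MvPolynomial (Fin 4) K,
      E' = deletePthPowers p TB - deletePthPowers p (U' ^ p * aeval θ' (deletePthPowers p TA)) := ⟨_, rfl⟩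
  have hE'M : X ℓ ^ p * E' ∈ originIdeal K ^ M := by
    rw [hE', mul_sub, hkey, add_sub_cancel_left]
    refine Ideal.sub_mem _ (SwapNorm.deletePthPowers_mem_pow p (SwapNorm.aeval_mem_pow hβ0 hE)) ?_
    exact SwapNorm.deletePthPowers_mem_pow p (Ideal.mul_mem_left _ _ hD)
  refine ⟨fun k => ?_, ?_, E', mem_pow_sub_of_X_pow_mul_mem hE'M, ?_⟩
  · -- origin-fixing
    rw [← hθ']
    by_cases hk : k = jr
    · rw [hk, hθ'j, map_mul, constantCoeff_X, zero_mul]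
    · rw [hθ'k k hk, map_sub, map_mul, hGt0 k, if_neg hk, add_zero, constantCoeff_C, ← hw]
      linear_combination b k * hWc
  · rw [← hU', hU'def, map_mul, hεc, hV0]
  · rw [hstepB, hstepA, hE', ← hθ', ← hU']
    ring

/-- **THE NEWBORN SLOT**: `transθ jr = x_ℓ · V` with `V(0) = λ`. [OURS] -/
theorem transθ_newborn {θ : Fin 4 → MvPolynomial (Fin 4) K} (hθ0 : ∀ k, constantCoeff (θ k) = 0) {ℓ jr : Fin 4}
    {β b : Fin 4 → K} (hbj : b jr = 0) {lam : K}
    (hdir : ∀ k, coeff (Finsupp.single ℓ 1) (θ k) + ∑ i ∈ Finset.univ.erase ℓ, coeff (Finsupp.single i 1) (θ k) * β i =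
      lam * (b k + if k = jr then 1 else 0)) (M : ℕ) :
    transθ θ ℓ β jr b M jr = X ℓ * blowupFactor ℓ β (θ jr) ∧ constantCoeff (blowupFactor ℓ β (θ jr)) = lam := by
  refine ⟨transθ_self θ ℓ β jr b M, ?_⟩
  rw [constantCoeff_blowupFactor_of_dir hθ0 hdir jr, if_pos rfl, hbj, zero_add, mul_one]

/-- **A KEPT SLOT**: if the real letter `k` is the image of a virtual slot `i ≠ ℓ` (`θ_k = x_i · E_i`, `E_i(0) ≠ 0`) and the
virtual point stays on that slot (`β_i = 0`), then `b_k = 0` (direction correspondence) and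
`transθ k = x_i · (E_i ∘ blowupSub · W)` with constant term of the unit `= E_i(0) · W(0)`, `W(0)·λ = 1`. [OURS] -/
theorem transθ_kept {θ : Fin 4 → MvPolynomial (Fin 4) K} (hθ0 : ∀ k, constantCoeff (θ k) = 0) {ℓ jr : Fin 4}
    {β b : Fin 4 → K} (hbj : b jr = 0) {lam : K} (hlam : lam ≠ 0)
    (hdir : ∀ k, coeff (Finsupp.single ℓ 1) (θ k) + ∑ i ∈ Finset.univ.erase ℓ, coeff (Finsupp.single i 1) (θ k) * β i =
      lam * (b k + if k = jr then 1 else 0)) {M : ℕ} (hM2 : 2 ≤ M)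
    {k i : Fin 4} {Ei : MvPolynomial (Fin 4) K} (hθk : θ k = X i * Ei) (hiℓ : i ≠ ℓ) (hβi : β i = 0) :
    b k = 0 ∧ k ≠ jr ∧
      transθ θ ℓ β jr b M k = X i * (aeval (blowupSub ℓ β) Ei * invModPow (blowupFactor ℓ β (θ jr)) M) ∧
      constantCoeff (aeval (blowupSub ℓ β) Ei * invModPow (blowupFactor ℓ β (θ jr)) M) =
        constantCoeff Ei * constantCoeff (invModPow (blowupFactor ℓ β (θ jr)) M) ∧
      constantCoeff (invModPow (blowupFactor ℓ β (θ jr)) M) * lam = 1 := by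
  classical
  -- the row `k` of the direction correspondence reads `0 = λ (b k + [k = jr])`
  have hrow : coeff (Finsupp.single ℓ 1) (θ k) + ∑ i' ∈ Finset.univ.erase ℓ, coeff (Finsupp.single i' 1) (θ k) * β i' = 0 := by
    have hcoef : ∀ m : Fin 4, coeff (Finsupp.single m 1) (θ k) = if m = i then constantCoeff Ei else 0 := by
      intro m
      rw [hθk, coeff_single_mul_add, constantCoeff_X, zero_mul, zero_add, coeff_X]
      by_cases hm : m = i
      · rw [hm, if_pos rfl, if_pos rfl, one_mul]
      · rw [if_neg (fun h => hm ((Finsupp.single_left_inj one_ne_zero).mp h).symm), if_neg hm, zero_mul]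
    simp_rw [hcoef]
    rw [if_neg hiℓ.symm, zero_add]
    simp_rw [ite_mul, zero_mul]
    rw [Finset.sum_ite_eq' (Finset.univ.erase ℓ) i, if_pos (Finset.mem_erase.mpr ⟨hiℓ, Finset.mem_univ i⟩), hβi, mul_zero]
  have hbk : b k + (if k = jr then 1 else 0) = 0 := by
    have h := hdir k
    rw [hrow] at h
    exact (mul_eq_zero.mp h.symm).resolve_left hlam
  have hkj : k ≠ jr := by
    intro h
    rw [h, hbj, if_pos rfl, zero_add] at hbk
    exact one_ne_zero hbk
  rw [if_neg hkj, add_zero] at hbk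
  have hV0 : constantCoeff (blowupFactor ℓ β (θ jr)) = lam := by
    rw [constantCoeff_blowupFactor_of_dir hθ0 hdir jr, if_pos rfl, hbj, zero_add, mul_one]
  obtain ⟨hWc, -, -⟩ := invModPow_spec (V := blowupFactor ℓ β (θ jr)) (by rw [hV0]; exact hlam) hM2
  rw [hV0] at hWc
  refine ⟨hbk, hkj, ?_, ?_, hWc⟩
  · rw [transθ_of_ne θ ℓ β b M hkj, hbk, C_0, sub_zero, hθk, blowupFactor_X_mul β hiℓ, hβi, C_0, add_zero]
    ring
  · rw [map_mul, constantCoeff_aeval_blowupSub]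

/-- **THE TANGENT ROWS OF THE TRANSPORTED FRAME**: `λ · coeff_{x_m}(transθ k) = coeff_{x_m} θ_k − b_k · coeff_{x_m} θ_jr`
for `k ≠ jr`, `m ≠ ℓ`, and `coeff_{x_m}(transθ jr) = λ · [m = ℓ]`. [OURS] [folklore] -/
theorem coeff_single_transθ {θ : Fin 4 → MvPolynomial (Fin 4) K} (hθ0 : ∀ k, constantCoeff (θ k) = 0) {ℓ jr : Fin 4}
    {β b : Fin 4 → K} (hbj : b jr = 0) {lam : K} (hlam : lam ≠ 0)
    (hdir : ∀ k, coeff (Finsupp.single ℓ 1) (θ k) + ∑ i ∈ Finset.univ.erase ℓ, coeff (Finsupp.single i 1) (θ k) * β i =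
      lam * (b k + if k = jr then 1 else 0)) {M : ℕ} (hM2 : 2 ≤ M) :
    (∀ k, k ≠ jr → ∀ m, m ≠ ℓ → lam * coeff (Finsupp.single m 1) (transθ θ ℓ β jr b M k) =
      coeff (Finsupp.single m 1) (θ k) - b k * coeff (Finsupp.single m 1) (θ jr)) ∧
    ∀ m, coeff (Finsupp.single m 1) (transθ θ ℓ β jr b M jr) = if m = ℓ then lam else 0 := by
  classical
  have hGt0 := constantCoeff_blowupFactor_of_dir hθ0 hdir
  have hV0 : constantCoeff (blowupFactor ℓ β (θ jr)) = lam := by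
    rw [hGt0 jr, if_pos rfl, hbj, zero_add, mul_one]
  obtain ⟨hWc, -, hWlin⟩ := invModPow_spec (V := blowupFactor ℓ β (θ jr)) (by rw [hV0]; exact hlam) hM2
  rw [hV0] at hWc hWlin
  refine ⟨fun k hk m hm => ?_, fun m => ?_⟩
  · rw [transθ_of_ne θ ℓ β b M hk, coeff_sub, coeff_C, if_neg (Ne.symm (Finsupp.single_ne_zero.mpr one_ne_zero)),
      sub_zero, coeff_single_mul_add, hGt0 k, if_neg hk, add_zero, (blowupFactor_spec ℓ β (hθ0 k)).2.2 m hm]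
    have h := hWlin m
    rw [(blowupFactor_spec ℓ β (hθ0 jr)).2.2 m hm] at h
    linear_combination (coeff (Finsupp.single m 1) (θ k) - b k * coeff (Finsupp.single m 1) (θ jr)) * hWc +
      lam * b k * h
  · rw [transθ_self, coeff_single_mul_add, constantCoeff_X, zero_mul, zero_add, coeff_X, hV0]
    by_cases hm : m = ℓ
    · rw [hm, if_pos rfl, if_pos rfl, one_mul]
    · rw [if_neg (fun h => hm ((Finsupp.single_left_inj one_ne_zero).mp h).symm), if_neg hm, zero_mul]

end SwapTransport

end Summit.ResolutionOfSingularities.ResolutionOfSingularities.Theorems.PIDim4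

end
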